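import Literature.NumberTheory.LFunctions.Equivalents
import Literature.NumberTheory.LFunctions.XiMultiplePositivityProofs
import Literature.NumberTheory.LFunctions.ZetaArgumentCertificate
import Literature.NumberTheory.DiophantineGeometry.NamedHypothesesRHProofs
import Literature.Analysis.Complex.JensenPolynomialSector
import Mathlib.Analysis.Complex.Polynomial.GaussLucas
import HarnessLib

/-!
# GORZ Theorem 2 — the Jensen polynomials `J^{d,n}_γ` of `Ξ` are hyperbolic for `d ≤ 8`, all `n`

Topic `Literature/NumberTheory/LFunctions`; second companion ("Proofs") file of `Equivalents.lean`
(the first, `EquivalentsProofs.lean`, proves GORZ Theorem 1, `gorz_eventually_holds`). It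
discharges the named fact `Literature.NumberTheory.LFunctions.gorz_le_eight` (**rh.S39**;
Griffin–Ono–Rolen–Zagier, PNAS 116 (2019), **Thm. 2**, p. 11104: "If `1 ≤ d ≤ 8`, then
`J^{d,n}_γ(X)` is hyperbolic for every `n ≥ 0`", `γ` the Taylor coefficients
`(-1 + 4z²) Λ(½ + z) = Σ γ(n) z^{2n}/n!` of eq. (1), "hyperbolic" = all zeros real =
`Polynomial.Splits` over `ℝ`).

## The proof given here

GORZ prove Thm. 2 (§5.2) by an effective form of their Hermite-polynomial limit (Thms. 1, 3, 7)
plus a computer check of Hermite's criterion for `n ≤ 10⁶`. We follow instead Kim–Lee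
(arXiv:2105.05386, **Thm. 4 and the Remark after it**: for an even real entire `f` of order `< 2`
with `Z(f) ⊂ {|Re z| ≥ T} ∪ ℝ`, `T ≥ 1/2`, `f(z) = f₀(z²)`, "`J(f₀⁽ⁿ⁾; d)` is hyperbolic for
`d ≤ T²(1 + 4⁻¹T⁻²)²` and for every `n`"), applied to the tree's genus-zero function
`G(w) = ξ(½ + √w)` (`Literature.NumberTheory.LFunctions.xiSq`, `γ(k) = 8 G⁽ᵏ⁾(0)`) and to the
Riemann hypothesis up to height `T = 16`, a THEOREM of the tree
(`Literature.NumberTheory.LFunctions.riemannHypothesisUpTo_sixteen`, Backlund's certificate checked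
by the kernel). This yields hyperbolicity of `J^{d,n}_γ` for every `n` and all `d ≤ 64`.

* `mem_of_aeval_derivative_eq_zero`: Gauss–Lucas into a convex set (Mathlib's
  `Polynomial.rootSet_derivative_subset_convexHull_rootSet`); hence, by the shift rule
  `J^{d,n}_P = J^{d,0}_{P⁽ⁿ⁾}` (`PolyaSchur.jensenPoly_taylorSeq_shift`) and Obreschkoff's theorem
  (`Obreschkoff.splits_jensenPoly_taylorSeq_of_roots_mem_sector`), ALL shifts `J^{d,n}` of the
  Taylor sequence of a real polynomial with roots in a convex `K ⊆ S(δ) = {|Im z| ≤ δ|z|}`,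
  `d δ² ≤ 1`, are hyperbolic (`splits_jensenPoly_taylorSeq_of_roots_mem_convex`).
* `splits_jensenPoly_taylor_of_zeros_mem_convex`: the same for real entire functions of order
  `< 1` — the proof of the tree's `Obreschkoff.splits_jensenPoly_taylor_of_zeros_mem_sector` (the
  case `n = 0`, `JensenPolynomialSector.lean`) with `K` in place of `S(δ)` (Hadamard in genus zero,
  real partial products, locally uniform limits, `PolyaSchur.splits_of_tendsto_coeff`).
* `xiSq_zeros_mem_negCone`: the zeros `(ρ - ½)²` of `G` lie, under RH up to height `T ≥ 1`, in
  the closed CONVEX cone `K_κ = {|Im w| ≤ -κ Re w}`, `κ = 2/T`, and `K_κ ⊆ S(κ)` (the double sector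
  `S(δ)` itself is not convex — Kim–Lee's point "`S̃` is convex").
* `jensenPoly_xiTaylorCoeff_splits_of_riemannHypothesisUpTo`: RH up to height `T ≥ 1` gives
  hyperbolicity of `J^{d,n}_γ` for `4d ≤ T²` and every `n`; `T = 16` gives `d ≤ 64`
  (`jensenPoly_xiTaylorCoeff_splits_of_le`), whence `gorz_le_eight_holds`.

Standard axioms only; no new definitions (the cone is a set-builder term).

## References

* [GORZPNAS2019] M. Griffin, K. Ono, L. Rolen, D. Zagier, *Jensen polynomials for the Riemann zeta
  function and other sequences*, PNAS 116 (2019) 11103–11110, Thm. 2, §5.2 (read, p. 2 and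
  pp. 10–11 of the journal offprint).
* [KimLee2021] Y.-O. Kim, J. Lee, *A note on the zeros of Jensen polynomials*, arXiv:2105.05386,
  Thm. 3 and Corollary, Thm. 4 and Remark (read, pp. 2–4).
* [Edwards1974] H. M. Edwards, *Riemann's Zeta Function*, §6.6 (Backlund's `N(T)` computation; the
  source of the height-16 certificate).
-/

noncomputable section

open Polynomial Finset Filter Metric Set Complex Topology
open scoped ComplexConjugate Nat

namespace Literature.NumberTheory.LFunctions

open Literature.Analysis.Complex.PolyaSchur Literature.Analysis.TotalPositivity
  Literature.Analysis.Complex.Obreschkoff Literature.NumberTheory.DiophantineGeometry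

/-! ## Gauss–Lucas into a convex set; Jensen polynomials of all shifts of a polynomial -/

/-- **Gauss–Lucas, convex-target form.** If all complex roots of a real polynomial `P` lie in a
convex set `K` and `P' ≠ 0`, then every complex root of `P'` lies in `K` (Mathlib's Gauss–Lucas
theorem `Polynomial.rootSet_derivative_subset_convexHull_rootSet` for `P` mapped to `ℂ[X]`, and
`convexHull_min`). [folklore] -/
theorem mem_of_aeval_derivative_eq_zero {K : Set ℂ} (hK : Convex ℝ K) {P : ℝ[X]}
    (hP : ∀ z : ℂ, aeval z P = 0 → z ∈ K) (hP' : derivative P ≠ 0) {z : ℂ}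
    (hz : aeval z (derivative P) = 0) : z ∈ K := by
  set Q : ℂ[X] := P.map (algebraMap ℝ ℂ) with hQ
  have hQ' : derivative Q = (derivative P).map (algebraMap ℝ ℂ) := derivative_map P _
  have hdQ0 : derivative Q ≠ 0 := by
    rw [hQ']
    exact (Polynomial.map_ne_zero_iff (algebraMap ℝ ℂ).injective).2 hP'
  have hdeg : 0 < Q.degree := by
    by_contra h
    rw [not_lt] at h
    exact hdQ0 (derivative_of_natDegree_zero (natDegree_eq_zero_iff_degree_le_zero.2 h))
  have hzroot : z ∈ (derivative Q).rootSet ℂ := by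
    rw [mem_rootSet]
    exact ⟨hdQ0, by rw [hQ', aeval_map_algebraMap]; exact hz⟩
  have hsub : Q.rootSet ℂ ⊆ K := fun w hw => by
    rw [mem_rootSet, hQ, aeval_map_algebraMap] at hw
    exact hP w hw.2
  exact convexHull_min hsub hK (rootSet_derivative_subset_convexHull_rootSet hdeg hzroot)

/-- Iterated Gauss–Lucas: if all complex roots of the real polynomial `P` lie in the convex set `K`
and `P⁽ⁿ⁾ ≠ 0`, then every complex root of `P⁽ⁿ⁾` lies in `K`. [folklore] -/
theorem mem_of_aeval_iterate_derivative_eq_zero {K : Set ℂ} (hK : Convex ℝ K) {P : ℝ[X]}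
    (hP : ∀ z : ℂ, aeval z P = 0 → z ∈ K) :
    ∀ n : ℕ, derivative^[n] P ≠ 0 → ∀ z : ℂ, aeval z (derivative^[n] P) = 0 → z ∈ K := by
  intro n
  induction n with
  | zero => exact fun _ z hz => hP z hz
  | succ n ih =>
    intro hn z hz
    rw [Function.iterate_succ_apply'] at hn hz
    have hn' : derivative^[n] P ≠ 0 := fun h => hn (by rw [h, derivative_zero])
    exact mem_of_aeval_derivative_eq_zero hK (ih hn') hn hz

/-- **All shifts, polynomial case** (Kim–Lee 2021, proof of Thm. 4: "`S̃` is convex … the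
Gauss–Lucas theorem implies …", combined with their Corollary to Thm. 3). If all complex roots of
`P ∈ ℝ[X]` lie in a convex set `K ⊆ S(δ)` and `d δ² ≤ 1`, then for EVERY `n` the Jensen polynomial
`J^{d,n}` of the Taylor sequence `(P⁽ᵏ⁾(0))_k` has only real zeros: `J^{d,n}_P = J^{d,0}_{P⁽ⁿ⁾}`
(`PolyaSchur.jensenPoly_taylorSeq_shift`), the roots of `P⁽ⁿ⁾` stay in `K ⊆ S(δ)`
(`mem_of_aeval_iterate_derivative_eq_zero`), and Obreschkoff's corollary
(`Obreschkoff.splits_jensenPoly_taylorSeq_of_roots_mem_sector`) applies (`P⁽ⁿ⁾ = 0` gives the zero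
polynomial, which splits). [cite: KimLee2021, Theorem 4 (proof) and Corollary to Theorem 3] -/
theorem splits_jensenPoly_taylorSeq_of_roots_mem_convex {K : Set ℂ} (hK : Convex ℝ K) {δ : ℝ}
    (hKδ : K ⊆ sector δ) {P : ℝ[X]} (hP : ∀ z : ℂ, aeval z P = 0 → z ∈ K) {d : ℕ}
    (hd : (d : ℝ) * δ ^ 2 ≤ 1) (n : ℕ) : (jensenPoly (taylorSeq P) d n).Splits := by
  rw [Literature.Analysis.Complex.PolyaSchur.jensenPoly_taylorSeq_shift]
  by_cases h : derivative^[n] P = 0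
  · rw [h]
    have h0 : jensenPoly (taylorSeq (0 : ℝ[X])) d 0 = 0 := by
      ext j
      simp [Literature.Analysis.Complex.PolyaSchur.coeff_jensenPoly, taylorSeq]
    rw [h0]
    exact Splits.zero
  · exact splits_jensenPoly_taylorSeq_of_roots_mem_sector
      (fun z hz => hKδ (mem_of_aeval_iterate_derivative_eq_zero hK hP n h z hz)) hd

/-! ## Entire functions of order `< 1` with zeros in a convex part of a sector -/

/-- **Jensen polynomials of every shift of a real entire function of order `< 1` whose zeros lie in
a convex part of a sector** (Kim–Lee 2021, Thm. 4 and the Remark after it, in genus zero). Let `F`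
be entire with `‖F z‖ ≤ C exp(‖z‖^ρ)` for some `ρ < 1`, real (`F(z̄) = conj F(z)`), `F 0 ≠ 0`, and
suppose every zero of `F` lies in a convex set `K ⊆ S(δ) = {|Im z| ≤ δ|z|}`. Then for `d δ² ≤ 1`
and every `n` the Jensen polynomial `J^{d,n}` of `(Re F⁽ᵏ⁾(0))_k` has only real zeros. The proof
is that of the tree's `Obreschkoff.splits_jensenPoly_taylor_of_zeros_mem_sector` (the case
`n = 0`, where convexity is not needed), with `K` in place of `S(δ)`: Hadamard's genus-zero product
with multiplicities (`Literature.Analysis.Complex.hadamard_genus_zero_zeros`), conjugation-invariant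
partial products lifted to REAL polynomials (`Obreschkoff.exists_real_lift_of_map_conj_eq`) whose
roots are zeros of `F`, hence in `K`, so that all their `J^{d,n}` are hyperbolic
(`splits_jensenPoly_taylorSeq_of_roots_mem_convex`); locally uniform convergence of the partial
products and of their Taylor coefficients, and `PolyaSchur.splits_of_tendsto_coeff`.
[cite: KimLee2021, Theorem 4 and Remark] -/
theorem splits_jensenPoly_taylor_of_zeros_mem_convex {F : ℂ → ℂ} (hF : IsEntireOfOrderLtOne F)
    (hreal : ∀ z, F (conj z) = conj (F z)) (h0 : F 0 ≠ 0) {K : Set ℂ} (hK : Convex ℝ K) {δ : ℝ}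
    (hKδ : K ⊆ sector δ) (hzero : ∀ z : ℂ, F z = 0 → z ∈ K) {d : ℕ} (hd : (d : ℝ) * δ ^ 2 ≤ 1)
    (n : ℕ) : (jensenPoly (fun k => (iteratedDeriv k F 0).re) d n).Splits := by
  classical
  obtain ⟨hdiff, ρ, C₀, hρ, hbound⟩ := hF
  obtain ⟨b, hb, hbzero, hbmult, hprod⟩ :=
    Literature.Analysis.Complex.hadamard_genus_zero_zeros F ρ C₀ hdiff hρ hbound h0
  -- `F 0` is real
  have hF0 : (((F 0).re : ℝ) : ℂ) = F 0 := by
    have h := hreal 0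
    rw [map_zero] at h
    exact conj_eq_iff_re.1 h.symm
  have hc0 : (F 0).re ≠ 0 := fun h => h0 (by rw [← hF0, h, ofReal_zero])
  -- finiteness of the sets of large `bᵢ`
  have hfin : ∀ ε : ℝ, 0 < ε → {i : ℕ | ε ≤ ‖b i‖}.Finite := fun ε hε => by
    have hev := hb.tendsto_cofinite_zero.eventually (gt_mem_nhds hε)
    refine (Filter.eventually_cofinite.1 hev).subset fun i hi => ?_
    simp only [mem_setOf_eq, not_lt] at hi ⊢
    simpa using hi
  -- conjugation symmetry of the multiplicities of the values of `b`
  have hsymm : ∀ v : ℂ, v ≠ 0 → {i | b i = v}.ncard = {i | b i = conj v}.ncard := fun v hv => by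
    have h1 := hbmult v⁻¹ (inv_ne_zero hv)
    have h2 := hbmult (conj v)⁻¹ (inv_ne_zero ((_root_.map_ne_zero _).2 hv))
    rw [inv_inv] at h1 h2
    rw [h1, h2, ← map_inv₀, analyticOrderNatAt_conj hdiff h0 hreal]
  -- the index sets `I k = {i < k : bᵢ = 0} ∪ {i : bᵢ ≠ 0, |1/bᵢ| ≤ k}`
  have hSfin : ∀ k : ℕ, {i : ℕ | b i ≠ 0 ∧ ‖b i‖⁻¹ ≤ k}.Finite := fun k => by
    refine (hfin ((k : ℝ) + 1)⁻¹ (by positivity)).subset fun i hi => ?_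
    obtain ⟨h1, h2⟩ := hi
    have hpos : 0 < ‖b i‖ := norm_pos_iff.2 h1
    exact inv_le_of_inv_le₀ hpos (h2.trans (by linarith))
  set I : ℕ → Finset ℕ := fun k => (range k).filter (fun i => b i = 0) ∪ (hSfin k).toFinset with hI
  have hmemI : ∀ k i, i ∈ I k ↔ (i < k ∧ b i = 0) ∨ (b i ≠ 0 ∧ ‖b i‖⁻¹ ≤ k) := fun k i => by
    simp [hI, Set.Finite.mem_toFinset]
  have hImono : Monotone I := fun k k' hkk' i hi => by
    rw [hmemI] at hi ⊢
    rcases hi with ⟨h1, h2⟩ | ⟨h1, h2⟩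
    · exact Or.inl ⟨lt_of_lt_of_le h1 hkk', h2⟩
    · exact Or.inr ⟨h1, h2.trans (by exact_mod_cast hkk')⟩
  have hIcov : ∀ i, ∃ k, i ∈ I k := fun i => by
    by_cases hi : b i = 0
    · exact ⟨i + 1, (hmemI _ _).2 (Or.inl ⟨i.lt_succ_self, hi⟩)⟩
    · exact ⟨⌈‖b i‖⁻¹⌉₊, (hmemI _ _).2 (Or.inr ⟨hi, Nat.le_ceil _⟩)⟩
  have hItend : Tendsto I atTop atTop := tendsto_atTop_finset_of_monotone hImono hIcov
  -- value counts on `I k`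
  have hcount : ∀ (k : ℕ) (v : ℂ), v ≠ 0 →
      #((I k).filter fun i => v = b i) = if ‖v‖⁻¹ ≤ k then {i | b i = v}.ncard else 0 := by
    intro k v hv
    have hvfin : {i | b i = v}.Finite :=
      (hfin ‖v‖ (norm_pos_iff.2 hv)).subset fun i hi => by
        simp only [mem_setOf_eq] at hi ⊢; rw [hi]
    split_ifs with hk
    · rw [Set.ncard_eq_toFinset_card _ hvfin]
      congr 1
      ext i
      simp only [mem_filter, hmemI, Set.Finite.mem_toFinset, mem_setOf_eq]
      constructor
      · rintro ⟨-, h⟩; exact h.symm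
      · intro h; exact ⟨Or.inr ⟨by rw [h]; exact hv, by rw [h]; exact hk⟩, h.symm⟩
    · rw [card_eq_zero, filter_eq_empty_iff]
      intro i hi h
      rw [hmemI] at hi
      rcases hi with ⟨-, h2⟩ | ⟨-, h2⟩
      · exact hv (by rw [h, h2])
      · exact hk (by rw [h]; exact h2)
  -- conjugation invariance of the multisets `b(I k)`
  have hIconj : ∀ k, ((I k).val.map b).map conj = (I k).val.map b := fun k => by
    ext w
    rw [show w = conj (conj w) from (conj_conj w).symm,
      Multiset.count_map_eq_count' _ _ (RingHom.injective _), conj_conj, Multiset.count_map,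
      Multiset.count_map]
    change #((I k).filter fun i => conj w = b i) = #((I k).filter fun i => w = b i)
    by_cases hw : w = 0
    · simp [hw]
    · rw [hcount k w hw, hcount k (conj w) ((_root_.map_ne_zero _).2 hw), norm_conj, ← hsymm w hw]
  -- the real approximants
  have hlift : ∀ k, ∃ p : ℝ[X], p.map (algebraMap ℝ ℂ) =
      (((I k).val.map b).map fun β => (1 - C β * X : ℂ[X])).prod :=
    fun k => exists_real_lift_of_map_conj_eq _ (hIconj k)
  choose p hp using hlift
  have hpeval : ∀ k (z : ℂ), ((p k).map (algebraMap ℝ ℂ)).eval z = ∏ i ∈ I k, (1 - b i * z) := by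
    intro k z
    rw [hp, Multiset.map_map, eval_multiset_prod, Multiset.map_map, Finset.prod_eq_multiset_prod]
    congr 1
    refine Multiset.map_congr rfl fun i _ => ?_
    simp
  -- their zeros are zeros of `F`, hence lie in `K`
  have hproots : ∀ k (z : ℂ), aeval z (p k) = 0 → z ∈ K := by
    intro k z hz
    rw [← eval_map_algebraMap, hpeval, Finset.prod_eq_zero_iff] at hz
    obtain ⟨i, -, hi⟩ := hz
    have hbi : b i ≠ 0 := by
      rintro h; rw [h, zero_mul, sub_zero] at hi; exact one_ne_zero hi
    have hz' : z = (b i)⁻¹ := by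
      have h1 : b i * z = 1 := (sub_eq_zero.1 hi).symm
      exact (eq_inv_of_mul_eq_one_right h1)
    rw [hz']
    exact hzero _ (hbzero i hbi)
  -- hence all their Jensen polynomials are hyperbolic (Gauss–Lucas + Obreschkoff)
  have hsplit : ∀ k, (jensenPoly (taylorSeq (p k)) d n).Splits :=
    fun k => splits_jensenPoly_taylorSeq_of_roots_mem_convex hK hKδ (hproots k) hd n
  -- locally uniform convergence of the partial products on the unit ball
  set G : ℕ → ℂ → ℂ := fun k z => ∏ i ∈ I k, (1 - b i * z) with hG
  have hloc : TendstoLocallyUniformlyOn G (fun z => F z / F 0) atTop (ball (0 : ℂ) 1) := by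
    have h := Summable.hasProdLocallyUniformlyOn_one_add (f := fun i (z : ℂ) => -(b i * z))
      (K := ball (0 : ℂ) 1) isOpen_ball hb (Eventually.of_forall fun i z hz => ?_)
      (fun i => (continuous_const.mul continuous_id).neg.continuousOn)
    · have h' : TendstoLocallyUniformlyOn (fun (s : Finset ℕ) (z : ℂ) => ∏ i ∈ s, (1 - b i * z))
          (fun z => F z / F 0) atTop (ball (0 : ℂ) 1) := by
        refine (h.congr fun s z _ => ?_).congr_right fun z _ => ?_
        · exact Finset.prod_congr rfl fun i _ => by ring
        · have h1 : HasProd (fun i => 1 + -(b i * z)) (F z / F 0) :=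
            (hprod z).congr_fun fun i => by ring
          exact h1.tprod_eq
      exact tendstoLocallyUniformlyOn_comp_of_tendsto h' hItend
    · rw [norm_neg, norm_mul]
      rw [mem_ball_zero_iff] at hz
      exact mul_le_of_le_one_right (norm_nonneg _) hz.le
  -- Taylor coefficients converge
  have hGp : ∀ k, G k = fun z => ((p k).map (algebraMap ℝ ℂ)).eval z :=
    fun k => funext fun z => (hpeval k z).symm
  have hGd : ∀ k, Differentiable ℂ (G k) := fun k => by
    rw [hGp]; exact Polynomial.differentiable _
  have hcoef : ∀ m, Tendsto (fun k => (iteratedDeriv m (G k) 0).re) atTop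
      (𝓝 ((iteratedDeriv m F 0).re / (F 0).re)) := fun m => by
    have h1 := ((tendstoLocallyUniformlyOn_iteratedDeriv isOpen_ball hGd hloc m).tendsto_at
      (mem_ball_self one_pos))
    have h2 : iteratedDeriv m (fun z => F z / F 0) 0 = iteratedDeriv m F 0 / F 0 :=
      iteratedDeriv_div_const _ _
    rw [h2] at h1
    have h3 := (continuous_re.tendsto _).comp h1
    rwa [← hF0, div_ofReal_re] at h3
  have htaylor : ∀ k m, (iteratedDeriv m (G k) 0).re = taylorSeq (p k) m := fun k m => by
    rw [hGp k]
    have : (fun z => ((p k).map (algebraMap ℝ ℂ)).eval z) =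
        fun z => ((p k).map Complex.ofRealHom).eval z := rfl
    rw [this, iteratedDeriv_polynomial_eval_zero, coeff_map, taylorSeq]
    simp
  -- pass to the limit for the sequence `γₘ / F(0)`, then rescale
  have key : (jensenPoly (fun m => (iteratedDeriv m F 0).re / (F 0).re) d n).Splits := by
    refine Literature.Analysis.Complex.PolyaSchur.splits_of_tendsto_coeff (l := atTop)
      (P := fun k => jensenPoly (taylorSeq (p k)) d n) (N := d)
      (fun k => Literature.Analysis.Complex.PolyaSchur.natDegree_jensenPoly_le _ _ _)
      (Literature.Analysis.Complex.PolyaSchur.natDegree_jensenPoly_le _ _ _) (fun j => ?_)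
      (Eventually.of_forall hsplit)
    by_cases hj : j ≤ d
    · simp only [Literature.Analysis.Complex.PolyaSchur.coeff_jensenPoly, if_pos hj, ← htaylor]
      exact (hcoef (n + j)).const_mul _
    · simp only [Literature.Analysis.Complex.PolyaSchur.coeff_jensenPoly, if_neg hj]
      exact tendsto_const_nhds
  have hresc : (fun m => (iteratedDeriv m F 0).re) =
      fun m => (F 0).re * ((iteratedDeriv m F 0).re / (F 0).re) := by
    funext m; field_simp
  rw [hresc, Literature.Analysis.Complex.PolyaSchur.jensenPoly_const_mul]
  exact key.C_mul _

/-! ## The cone around the negative real axis and the zeros of `G(w) = ξ(½ + √w)` -/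

/-- The closed cone `K_κ = {|Im z| ≤ -κ Re z}` (half-opening `arctan κ` around the negative real
axis, written as two linear inequalities) is convex. [folklore] -/
theorem convex_negCone (κ : ℝ) :
    Convex ℝ {z : ℂ | z.im + κ * z.re ≤ 0 ∧ -z.im + κ * z.re ≤ 0} := by
  have h1 : Convex ℝ {z : ℂ | z.im + κ * z.re ≤ 0} :=
    convex_halfSpace_le ⟨fun x y => by simp only [add_im, add_re]; ring,
      fun c x => by simp only [smul_im, smul_re, smul_eq_mul]; ring⟩ 0
  have h2 : Convex ℝ {z : ℂ | -z.im + κ * z.re ≤ 0} :=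
    convex_halfSpace_le ⟨fun x y => by simp only [add_im, add_re]; ring,
      fun c x => by simp only [smul_im, smul_re, smul_eq_mul]; ring⟩ 0
  rw [Set.setOf_and]
  exact h1.inter h2

/-- For `κ ≥ 0` the cone `K_κ` lies in Kim–Lee's double sector `S(κ) = {|Im z| ≤ κ|z|}`
(`|Im z| ≤ -κ Re z ≤ κ|z|`). [folklore] -/
theorem negCone_subset_sector {κ : ℝ} (hκ : 0 ≤ κ) :
    {z : ℂ | z.im + κ * z.re ≤ 0 ∧ -z.im + κ * z.re ≤ 0} ⊆ sector κ := by
  rintro z ⟨h1, h2⟩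
  rw [mem_sector, abs_le]
  have hre : -z.re ≤ ‖z‖ := (neg_le_abs z.re).trans (abs_re_le_norm z)
  have h3 : κ * (-z.re) ≤ κ * ‖z‖ := mul_le_mul_of_nonneg_left hre hκ
  constructor <;> linarith

/-- **The zeros of `G` under RH up to height `T`** (the geometry of Kim–Lee 2021, Thm. 4, for
`f = Ξ`: "`Z(f₀) ⊂ S̃`"). If every zero of `ζ` with `0 < Im ρ ≤ T` has `Re ρ = ½` (`T ≥ 1`), and
`κ ≥ 0` satisfies `κ T ≥ 2`, then every zero `w` of `G` (`G(w) = ξ(½ + √w)`,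
`Literature.NumberTheory.LFunctions.xiSq`) lies in the cone `K_κ = {|Im w| ≤ -κ Re w}`. Indeed
`w = (ρ - ½)²` with `ζ(ρ) = 0`, `0 < Re ρ < 1` (`riemannXi_eq_zero_iff_holds`); writing
`x = Re ρ - ½`, `y = Im ρ`: `Re w = x² - y²`, `Im w = 2xy`; if `|y| ≤ T` then `x = 0` (RH up to `T`,
conjugation symmetry, no real zeros in the strip) and `w = -y²`; if `|y| > T ≥ 1` then
`T|xy| ≤ T|y|/2 ≤ y²/2 ≤ y² - x²`. [cite: KimLee2021, Theorem 4 (proof)] -/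
theorem xiSq_zeros_mem_negCone {T κ : ℝ} (hT : 1 ≤ T) (hκ : 0 ≤ κ) (hκT : 2 ≤ κ * T)
    (hRH : RiemannHypothesisUpTo T) {w : ℂ} (hw : xiSq w = 0) :
    w ∈ {z : ℂ | z.im + κ * z.re ≤ 0 ∧ -z.im + κ * z.re ≤ 0} := by
  rw [xiSq_eq] at hw
  obtain ⟨hζ, h0, h1⟩ := (riemannXi_eq_zero_iff_holds _).1 hw
  set ρ : ℂ := 1 / 2 + w ^ (2⁻¹ : ℂ) with hρ
  have hwρ : (ρ - 1 / 2) ^ 2 = w := by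
    rw [hρ, add_sub_cancel_left]
    exact_mod_cast Complex.cpow_nat_inv_pow w two_ne_zero
  set x : ℝ := ρ.re - 1 / 2 with hx
  set y : ℝ := ρ.im with hy
  have hre : w.re = x ^ 2 - y ^ 2 := by
    rw [← hwρ, hx, hy]; simp [sq]
  have him : w.im = 2 * x * y := by
    rw [← hwρ, hx, hy]; simp [sq]; ring
  have hxabs : |x| ≤ 1 / 2 := by
    rw [abs_le, hx]; constructor <;> linarith
  have hT0 : 0 < T := by linarith
  -- the key inequality `T |x y| ≤ y² - x²`
  have key : T * |x * y| ≤ y ^ 2 - x ^ 2 := by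
    by_cases hyT : |y| ≤ T
    · -- RH up to height `T`: the zero is on the critical line
      have hxz : x = 0 := by
        rcases lt_trichotomy y 0 with hneg | hzero | hpos
        · have := hRH.re_eq_of_im_neg hζ hneg (by rw [hy] at hyT; exact (neg_le_abs _).trans hyT)
          rw [hx, this, sub_self]
        · exact absurd hζ (riemannZeta_ne_zero_of_im_eq_zero_of_pos_of_lt_one hzero h0 h1)
        · have := hRH ρ hζ hpos ((le_abs_self _).trans hyT)
          rw [hx, this, sub_self]
      rw [hxz]
      simp only [zero_mul, abs_zero, mul_zero]
      nlinarith [sq_nonneg y]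
    · rw [not_le] at hyT
      have hy1 : 1 ≤ |y| := hT.trans hyT.le
      have hysq : 1 ≤ y ^ 2 := by
        rw [← sq_abs]; nlinarith
      have hxsq : x ^ 2 ≤ 1 / 4 := by
        rw [← sq_abs]; nlinarith [abs_nonneg x]
      have h2 : T * |x * y| ≤ y ^ 2 / 2 := by
        rw [abs_mul]
        have ha : T * (|x| * |y|) ≤ T * (1 / 2 * |y|) :=
          mul_le_mul_of_nonneg_left (mul_le_mul_of_nonneg_right hxabs (abs_nonneg y)) hT0.le
        have hb : T * (1 / 2 * |y|) ≤ |y| * (1 / 2 * |y|) :=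
          mul_le_mul_of_nonneg_right hyT.le (by positivity)
        have hc : |y| * (1 / 2 * |y|) = y ^ 2 / 2 := by rw [← sq_abs]; ring
        linarith
      linarith
  -- from `T |xy| ≤ y² - x²` and `κ T ≥ 2` to the two linear inequalities
  have hk1 : κ * (T * |x * y|) ≤ κ * (y ^ 2 - x ^ 2) := mul_le_mul_of_nonneg_left key hκ
  have hk2 : 2 * |x * y| ≤ κ * T * |x * y| := mul_le_mul_of_nonneg_right hκT (abs_nonneg _)
  have hk3 : x * y ≤ |x * y| := le_abs_self _
  have hk4 : -(x * y) ≤ |x * y| := neg_le_abs _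
  simp only [mem_setOf_eq, hre, him]
  constructor <;> nlinarith

/-! ## Assembly: GORZ Theorem 2 -/

/-- **RH up to height `T` makes `J^{d,n}_γ` hyperbolic for `4d ≤ T²` and every `n`** (Kim–Lee
2021, Thm. 4 and Remark, with the cruder range `4d ≤ T²` in place of `d ≤ T²(1 + 4⁻¹T⁻²)²`). If
every zero `ρ` of `ζ` with `0 < Im ρ ≤ T` has `Re ρ = ½` (`T ≥ 1`), then the Jensen polynomial
`J^{d,n}_γ` of the Taylor coefficients `γ` of `(-1 + 4z²) Λ(½ + z)` splits over `ℝ` for all `n` and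
all `d` with `4d ≤ T²`: `splits_jensenPoly_taylor_of_zeros_mem_convex` for `G = xiSq` (order
`≤ 7/8 < 1`, real, `G(0) = ξ(½) ≠ 0`, zeros in the convex cone `K_{2/T} ⊆ S(2/T)`), and
`γ(k) = 8 Re G⁽ᵏ⁾(0)`. [cite: KimLee2021, Theorem 4 and Remark] -/
theorem jensenPoly_xiTaylorCoeff_splits_of_riemannHypothesisUpTo {T : ℝ} (hT : 1 ≤ T)
    (hRH : RiemannHypothesisUpTo T) {d : ℕ} (hd : 4 * (d : ℝ) ≤ T ^ 2) (n : ℕ) :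
    (jensenPoly xiTaylorCoeff d n).Splits := by
  obtain ⟨C₀, hC₀⟩ := norm_xiSq_le
  have hF : IsEntireOfOrderLtOne xiSq := ⟨differentiable_xiSq, 7 / 8, C₀, by norm_num, hC₀⟩
  have hT0 : 0 < T := by linarith
  have hκ : (0 : ℝ) ≤ 2 / T := by positivity
  have hκT : (2 : ℝ) ≤ 2 / T * T := by rw [div_mul_cancel₀ _ hT0.ne']
  have hδ : (d : ℝ) * (2 / T) ^ 2 ≤ 1 := by
    rw [div_pow, ← mul_div_assoc, div_le_one (by positivity)]
    linarith
  have h := splits_jensenPoly_taylor_of_zeros_mem_convex hF xiSq_conj xiSq_zero_ne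
    (convex_negCone (2 / T)) (negCone_subset_sector hκ)
    (fun z hz => xiSq_zeros_mem_negCone hT hκ hκT hRH hz) hδ n
  -- the Taylor coefficients of `G` at `0` are `γ(k)/8` (`re_iteratedDeriv_xiSq_div`)
  have hcoef : (fun k => (iteratedDeriv k xiSq 0).re) = fun k => 8⁻¹ * xiTaylorCoeff k := by
    funext k
    have h1 := re_iteratedDeriv_xiSq_div k
    have hk : (k ! : ℝ) ≠ 0 := by positivity
    rwa [← mul_div_assoc, div_left_inj' hk] at h1
  rw [hcoef, Literature.Analysis.Complex.PolyaSchur.jensenPoly_const_mul] at h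
  have h8 : jensenPoly xiTaylorCoeff d n =
      Polynomial.C (8 : ℝ) * (Polynomial.C (8⁻¹ : ℝ) * jensenPoly xiTaylorCoeff d n) := by
    rw [← mul_assoc, ← C_mul, mul_inv_cancel₀ (by norm_num : (8 : ℝ) ≠ 0), C_1, one_mul]
  rw [h8]
  exact h.C_mul 8

/-- **Hyperbolicity of `J^{d,n}_γ` for all `d ≤ 64` and all `n`, unconditionally**: the Riemann
hypothesis up to height `16` is a theorem of the tree (`riemannHypothesisUpTo_sixteen`, Backlund's
certificate checked by the kernel), and `4 · 64 = 16²`. (Kim–Lee's Remark records `d ≤ 9·10²⁴`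
from the Platt–Trudgian verification to height `3·10¹²`, which is a named fact, not a theorem,
here.) [cite: KimLee2021, Theorem 4 and Remark] -/
theorem jensenPoly_xiTaylorCoeff_splits_of_le {d : ℕ} (hd : d ≤ 64) (n : ℕ) :
    (jensenPoly xiTaylorCoeff d n).Splits := by
  refine jensenPoly_xiTaylorCoeff_splits_of_riemannHypothesisUpTo (T := 16) (by norm_num)
    riemannHypothesisUpTo_sixteen ?_ n
  have : (d : ℝ) ≤ 64 := by exact_mod_cast hd
  linarith

/-- **Discharge of `Literature.NumberTheory.LFunctions.gorz_le_eight` — Griffin–Ono–Rolen–Zagier,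
Theorem 2** (PNAS 116 (2019), Thm. 2: "If `1 ≤ d ≤ 8`, then `J^{d,n}_γ(X)` is hyperbolic for every
`n ≥ 0`"; `d ≤ 3` being due to Csordas–Norfolk–Varga 1986 and Dimitrov–Lucas 2011). Proved here
not by GORZ's effective asymptotics and computer check (§5.2) but by Kim–Lee's sector argument
(Obreschkoff + Gauss–Lucas + Hadamard, `jensenPoly_xiTaylorCoeff_splits_of_le`) from the
kernel-certified Riemann hypothesis up to height `16`, which gives all `d ≤ 64`.
[cite: GORZPNAS2019, Theorem 2] -/
theorem gorz_le_eight_holds : gorz_le_eight := fun _ _ hd' n =>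
  jensenPoly_xiTaylorCoeff_splits_of_le (hd'.trans (by norm_num)) n

end Literature.NumberTheory.LFunctions

end
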